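import Literature.AnabelianGeometry.EtaleTheta.Cyclotome
import Mathlib.RepresentationTheory.Homological.GroupCohomology.LowDegree

/-!
# The Kummer class of an invariant element: `κ : M^H → H¹(H, Λ(M))`

Source: LANA Project interim report [LANA2026Report], §6.1 "Generalities on Kummer maps",
p. 31. For a group `G` acting on a commutative monoid `M` (here: on a commutative group `A`,
playing the role of `M^gp`; the monoid case is reduced to this one by groupification) the report
considers, for a positive integer `n` and a subgroup `H ≤ G`, the sequence
`0 → M^gp[n] → M^gp —n→ M^gp → 0` and the induced "canonical map"

  `M^H → (M^gp)^H → H¹(H, M^gp[n])`,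

"and taking limits in `n`, we obtain `M^H → (M^gp)^H → H¹(H, Λ(M))`".

## What is here (real mathematics, proved)

For `a ∈ A` fixed by `H` and a compatible system of roots `x` of `a`
(`Literature/AnabelianGeometry/EtaleTheta/Cyclotome.lean`):

* `RootSystem.kummerCocycle` : the function `h ↦ (h • x n / x n)_n : H → Λ(A)`; it is a
  multiplicative `1`-cocycle (`isMulCocycle₁_kummerCocycle`), it is multiplicative in `x`, and
  changing the root system changes it by the coboundary of an element of `Λ(A)`;
* `kummerClassOfRootSystem` : its class in Mathlib's `groupCohomology.H1` of the `H`-module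
  `Λ(A)` (`Rep.ofMulDistribMulAction H (cyclotome A)`), and `kummerClassOfRootSystem_eq` : the
  class does not depend on the root system — this is the connecting-homomorphism class of the
  source, with the limit over `n` already taken;
* `kummerClass` / `kummerMapFixed` : for a rootable (`n`-divisible for all `n`, hypothesis (a)
  of loc. cit.) group, the resulting homomorphism `A^H → H¹(H, Λ(A))` (additively written on
  the target, as Mathlib's `H1` is a `ℤ`-module).

The colimit over `H`, the `G`-equivariance and the functoriality square of [LANA2026Report,
§6.1 pp.31–32] are in the companion files `KummerFunctoriality.lean` / `KummerMap.lean`.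

## Conventions

Because Mathlib's `groupCohomology` lives in a single universe, the group `G` and the module
`A` are taken in `Type`. Everything is discrete (no topology): topology is deliberately ignored
here, as [LANA2026Report, §6.1] is stated for abstract groups and monoids. For a TOPOLOGICAL group
the discrete `H¹` used here is in general larger than the continuous `H¹` of the source; the
continuous refinement is `EtaleTheta/ContH1.lean` together with the bridge files
`EtaleTheta/KummerComparison.lean` (`RootSystem.continuous_kummerCocycle`: under the
open-stabiliser hypothesis the Kummer cocycle IS continuous; level-`n` comparison with the [FrdII]
Def. 2.1 (ii) Kummer class of `Frobenioids/KummerClass.lean`), `EtaleTheta/ContH1Discrete.lean`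
(the injective forgetful map `ContH1.toDiscreteH1` to this discrete `H¹`) and
`EtaleTheta/KummerContH1.lean` (the Kummer class in `ContH1` and its comparison with the one here).
-/

namespace Literature.AnabelianGeometry.EtaleTheta

open groupCohomology

section Cocycle

variable {G : Type*} [Group G] {A : Type*} [CommGroup A] [MulDistribMulAction G A]

namespace RootSystem

variable {H : Subgroup G} {a b : A}

/-- The **Kummer cocycle** of a compatible system of roots `x` of an `H`-invariant element `a`:
`h ↦ (h • x n / x n)_{n}`, a function `H → Λ(A)`. This is the cochain-level form of the
connecting map `(M^gp)^H → H¹(H, M^gp[n])` of [cite: LANA2026Report, §6.1 p.31], with the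
limit over `n` built in. -/
def kummerCocycle (x : RootSystem a) (ha : a ∈ MulAction.fixedPoints H A) (h : H) :
    cyclotome A :=
  ⟨fun n => (h • x.root n) / x.root n,
    ⟨fun n => by rw [div_pow, ← smul_pow', x.pow_self, ha h, div_self'],
      fun n m => by rw [div_pow, ← smul_pow', x.root_mul_pow]⟩⟩

/-- Components of the Kummer cocycle. [cite: LANA2026Report, §6.1 p.31] -/
@[simp] theorem kummerCocycle_apply (x : RootSystem a) (ha : a ∈ MulAction.fixedPoints H A)
    (h : H) (n : ℕ+) :
    ((x.kummerCocycle ha h : cyclotome A) : ℕ+ → A) n = (h • x.root n) / x.root n := rfl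

/-- The Kummer cocycle is a multiplicative `1`-cocycle: `κ(gh) = g • κ(h) · κ(g)`.
[cite: LANA2026Report, §6.1 p.31] -/
theorem isMulCocycle₁_kummerCocycle (x : RootSystem a) (ha : a ∈ MulAction.fixedPoints H A) :
    IsMulCocycle₁ (x.kummerCocycle ha) := by
  intro g h
  refine Subtype.ext (funext fun n => ?_)
  change ((g * h) • x.root n) / x.root n =
    g • ((h • x.root n) / x.root n) * ((g • x.root n) / x.root n)
  rw [mul_smul, smul_div', div_mul_div_cancel]

/-- The Kummer cocycle of a product of root systems is the product of the Kummer cocycles.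
[cite: LANA2026Report, §6.1 p.31] -/
theorem kummerCocycle_mul (x : RootSystem a) (y : RootSystem b)
    (ha : a ∈ MulAction.fixedPoints H A) (hb : b ∈ MulAction.fixedPoints H A)
    (hab : a * b ∈ MulAction.fixedPoints H A) (h : H) :
    (x.mul y).kummerCocycle hab h = x.kummerCocycle ha h * y.kummerCocycle hb h := by
  refine Subtype.ext (funext fun n => ?_)
  change (h • (x.root n * y.root n)) / (x.root n * y.root n) =
    (h • x.root n) / x.root n * ((h • y.root n) / y.root n)
  rw [smul_mul', mul_div_mul_comm]

/-- Changing the root system changes the Kummer cocycle by a coboundary: with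
`ζ = x / y ∈ Λ(A)`, `κ_x(h) / κ_y(h) = h • ζ / ζ`. [cite: LANA2026Report, §6.1 p.31] -/
theorem kummerCocycle_div_kummerCocycle (x y : RootSystem a)
    (ha : a ∈ MulAction.fixedPoints H A) (h : H) :
    x.kummerCocycle ha h / y.kummerCocycle ha h = h • divCyclotome y x / divCyclotome y x := by
  refine Subtype.ext (funext fun n => ?_)
  change (h • x.root n) / x.root n / ((h • y.root n) / y.root n) =
    (h • (x.root n / y.root n)) / (x.root n / y.root n)
  rw [smul_div', div_div_div_comm]

/-- Hence the quotient of two Kummer cocycles of the same element is a multiplicative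
`1`-coboundary. [cite: LANA2026Report, §6.1 p.31] -/
theorem isMulCoboundary₁_kummerCocycle_div (x y : RootSystem a)
    (ha : a ∈ MulAction.fixedPoints H A) :
    IsMulCoboundary₁ (fun h => x.kummerCocycle ha h / y.kummerCocycle ha h) :=
  ⟨divCyclotome y x, fun h => (kummerCocycle_div_kummerCocycle x y ha h).symm⟩

/-- Transport under `G`: for `g : G`, the Kummer cocycle of the transported root system `g • x`
of `g • a` (invariant under `g H g⁻¹`) at `g h g⁻¹` is `g •` the Kummer cocycle of `x` at `h`.
This is the cochain-level content of "`κ` is `G`-equivariant with respect to the natural action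
of `G` on `H¹`" [cite: LANA2026Report, §6.1 p.31]. -/
theorem kummerCocycle_smul_conj (x : RootSystem a) (ha : a ∈ MulAction.fixedPoints H A) (g : G)
    (hga : g • a ∈ MulAction.fixedPoints (H.map (MulAut.conj g).toMonoidHom) A) (h : H) :
    (x.smul g).kummerCocycle hga ⟨g * h * g⁻¹, ⟨h, h.2, rfl⟩⟩ = g • x.kummerCocycle ha h := by
  refine Subtype.ext (funext fun n => ?_)
  change ((g * h * g⁻¹) • (g • x.root n)) / (g • x.root n) = g • ((h • x.root n) / x.root n)
  rw [smul_smul, mul_assoc, inv_mul_cancel, mul_one, mul_smul, smul_div']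
  rfl

end RootSystem

end Cocycle

section Class

variable {G : Type} [Group G] {A : Type} [CommGroup A] [MulDistribMulAction G A]
variable (H : Subgroup G) {a b : A}

/-- The `H`-module `Λ(A)` as an object of Mathlib's `Rep ℤ H` (on `Additive (cyclotome A)`).
[cite: LANA2026Report, §6.1 p.31] -/
noncomputable abbrev cyclotomeRep : Rep ℤ H := Rep.ofMulDistribMulAction H (cyclotome A)

/-- The Kummer cocycle as an element of Mathlib's `1`-cocycles `Z¹(H, Λ(A))`.
[cite: LANA2026Report, §6.1 p.31] -/
noncomputable def kummerCocycles₁ (x : RootSystem a) (ha : a ∈ MulAction.fixedPoints H A) :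
    cocycles₁ (cyclotomeRep (A := A) H) :=
  cocyclesOfIsMulCocycle₁ (x.isMulCocycle₁_kummerCocycle ha)

/-- Underlying function of `kummerCocycles₁`. [cite: LANA2026Report, §6.1 p.31] -/
@[simp] theorem kummerCocycles₁_apply (x : RootSystem a) (ha : a ∈ MulAction.fixedPoints H A)
    (h : H) : kummerCocycles₁ H x ha h = Additive.ofMul (x.kummerCocycle ha h) := rfl

/-- The **Kummer class** of an `H`-invariant element computed from a given compatible system of
roots: the class of the Kummer cocycle in `H¹(H, Λ(A))` (Mathlib `groupCohomology.H1`).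
[cite: LANA2026Report, §6.1 p.31] -/
noncomputable def kummerClassOfRootSystem (x : RootSystem a)
    (ha : a ∈ MulAction.fixedPoints H A) : H1 (cyclotomeRep (A := A) H) :=
  H1π _ (kummerCocycles₁ H x ha)

/-- The Kummer class does not depend on the chosen compatible system of roots: two choices
differ by the coboundary of `x / y ∈ Λ(A)`. [cite: LANA2026Report, §6.1 p.31] -/
theorem kummerClassOfRootSystem_eq (x y : RootSystem a) (ha : a ∈ MulAction.fixedPoints H A) :
    kummerClassOfRootSystem H x ha = kummerClassOfRootSystem H y ha := by
  rw [kummerClassOfRootSystem, kummerClassOfRootSystem, H1π_eq_iff]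
  have hfun : (⇑(kummerCocycles₁ H x ha) - ⇑(kummerCocycles₁ H y ha) : H → Additive (cyclotome A))
      = Additive.ofMul ∘ fun h => x.kummerCocycle ha h / y.kummerCocycle ha h := by
    funext h
    exact (ofMul_div _ _).symm
  rw [hfun]
  exact (coboundariesOfIsMulCoboundary₁ (RootSystem.isMulCoboundary₁_kummerCocycle_div x y ha)).2

/-- The Kummer class of a product, computed with the product root system, is the sum of the
Kummer classes (`H¹` is written additively). [cite: LANA2026Report, §6.1 p.31] -/
theorem kummerClassOfRootSystem_mul (x : RootSystem a) (y : RootSystem b)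
    (ha : a ∈ MulAction.fixedPoints H A) (hb : b ∈ MulAction.fixedPoints H A)
    (hab : a * b ∈ MulAction.fixedPoints H A) :
    kummerClassOfRootSystem H (x.mul y) hab =
      kummerClassOfRootSystem H x ha + kummerClassOfRootSystem H y hb := by
  rw [kummerClassOfRootSystem, kummerClassOfRootSystem, kummerClassOfRootSystem, ← map_add]
  congr 1
  refine cocycles₁_ext fun h => ?_
  change Additive.ofMul ((x.mul y).kummerCocycle hab h) =
    Additive.ofMul (x.kummerCocycle ha h) + Additive.ofMul (y.kummerCocycle hb h)
  rw [RootSystem.kummerCocycle_mul x y ha hb hab, ofMul_mul]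

/-- The Kummer class of the trivial root system of `1` vanishes.
[cite: LANA2026Report, §6.1 p.31] -/
theorem kummerClassOfRootSystem_one (h1 : (1 : A) ∈ MulAction.fixedPoints H A) :
    kummerClassOfRootSystem H RootSystem.one h1 = 0 := by
  have h0 : kummerCocycles₁ H RootSystem.one h1 = 0 := by
    refine cocycles₁_ext fun h => ?_
    change Additive.ofMul (RootSystem.one.kummerCocycle h1 h) = Additive.ofMul 1
    congr 1
    refine Subtype.ext (funext fun n => ?_)
    change (h • (1 : ℕ+ → A) n) / (1 : ℕ+ → A) n = 1
    rw [Pi.one_apply, smul_one, div_one]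
  rw [kummerClassOfRootSystem, h0, map_zero]

/-- The subgroup `A^H` of `H`-invariants (Mathlib's `FixedPoints.subgroup`), recorded under the
source's name. [cite: LANA2026Report, §6.1 p.31] -/
abbrev invariants : Subgroup A := FixedPoints.subgroup H A

variable [RootableBy A ℕ]

/-- The **Kummer class** `κ(a) ∈ H¹(H, Λ(A))` of an `H`-invariant element of a rootable
commutative `G`-group `A`, i.e. the map "`(M^gp)^H → H¹(H, Λ(M))`" of
[cite: LANA2026Report, §6.1 p.31] (computed with the root system `RootSystem.ofRootableBy a`;
independent of that choice by `kummerClassOfRootSystem_eq`). -/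
noncomputable def kummerClass (a : invariants (A := A) H) : H1 (cyclotomeRep (A := A) H) :=
  kummerClassOfRootSystem H (RootSystem.ofRootableBy (a : A)) a.2

/-- `kummerClass` may be computed with any compatible system of roots.
[cite: LANA2026Report, §6.1 p.31] -/
theorem kummerClass_eq_of_rootSystem (a : invariants (A := A) H) (x : RootSystem (a : A)) :
    kummerClass H a = kummerClassOfRootSystem H x a.2 :=
  kummerClassOfRootSystem_eq H _ x a.2

/-- The Kummer class is multiplicative-to-additive: `κ(ab) = κ(a) + κ(b)`.
[cite: LANA2026Report, §6.1 p.31] -/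
theorem kummerClass_mul (a b : invariants (A := A) H) :
    kummerClass H (a * b) = kummerClass H a + kummerClass H b := by
  rw [kummerClass_eq_of_rootSystem H (a * b)
    ((RootSystem.ofRootableBy (a : A)).mul (RootSystem.ofRootableBy (b : A)))]
  exact kummerClassOfRootSystem_mul H _ _ a.2 b.2 (a * b).2

/-- `κ(1) = 0`. [cite: LANA2026Report, §6.1 p.31] -/
theorem kummerClass_one : kummerClass H (1 : invariants (A := A) H) = 0 := by
  rw [kummerClass_eq_of_rootSystem H 1 RootSystem.one]
  exact kummerClassOfRootSystem_one H (1 : invariants (A := A) H).2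

/-- The **Kummer map at level `H`**: the group homomorphism `A^H → H¹(H, Λ(A))`
(source: "`M^H → (M^gp)^H → H¹(H, Λ(M))`", [cite: LANA2026Report, §6.1 p.31]), from the
multiplicative group of invariants to the additively written cohomology group. -/
noncomputable def kummerMapFixed : Additive (invariants (A := A) H) →+ H1 (cyclotomeRep (A := A) H)
    where
  toFun a := kummerClass H a.toMul
  map_zero' := kummerClass_one H
  map_add' a b := kummerClass_mul H a.toMul b.toMul

/-- `kummerMapFixed` on `ofMul a` is the Kummer class of `a`. [cite: LANA2026Report, §6.1 p.31] -/
@[simp] theorem kummerMapFixed_apply (a : invariants (A := A) H) :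
    kummerMapFixed H (Additive.ofMul a) = kummerClass H a := rfl

end Class

end Literature.AnabelianGeometry.EtaleTheta
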